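import Literature.NumberTheory.EllipticCurves.BSDSelmerKimPConverse
import HarnessLib

/-!
# Kim 2022, Cor. 1.4 (bsd.S25): the core of Thm. 1.1 as the one new named leaf, and the assembly

Family `bsd`, topic `NumberTheory/EllipticCurves`. Fact decomposition (librarian, `fact-decompose`,
human ruling 2026-08-16, an explicit exception for budget-capped facts) of the named fact
`Literature.NumberTheory.EllipticCurves.kim_analyticRank_eq_one_of_mordellWeilRank_eq_one`
(`BSDSelmer.lean`; C.-H. Kim, *On the soft `p`-converse to a theorem of Gross–Zagier and
Kolyvagin*, Math. Ann. 387 (2023), 1961–1968 (online 2022) = arXiv:2109.12344, **Cor. 1.4**: for `E/ℚ` non-CM,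
`rk_ℤ E(ℚ) = 1` and `#Ш(E/ℚ)[p^∞] < ∞` for one good ordinary `p > 3` with `E[p]` irreducible
`⟹ ord_{s=1} L(E, s) = 1`, and in particular `#Ш(E/ℚ) < ∞`).

## Text versions (ARM P D-audit, reader bsd-cited-r10, sheet `D-AUDIT-r10-S2.md` sha16 e834568ff3dcc1ae
§A.1 / §D F3; typer bsd-cited-ty4, DOC-DEBT DD-26, 2026-08-27 — statements in this file untouched)

Every quotation and theorem NUMBER in this file is the HELD text `paper:arxiv-2109.12344` = arXiv
**v1** (25 Sep 2021, title "On the `p`-converse …"). The JOURNAL text (Math. Ann. 387 (2023), no. 3-4,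
1961–1968, published online 2022, doi 10.1007/s00208-022-02511-8) is arXiv **v3** (2 Nov 2022, "Title
changed. The revision is made following the referee's suggestions"; e-print TeX source
`strSelmer-kappa-p-converse-revise-2.tex`, 375 lines, sha16 a0140afdc6cc21a6, read by the typer —
copy under `pub/bsd-cited/staging/bsd-cited-ty4/DD26-K22/`; theorem counter reconstructed from it =
the reader's PDF reading and the density cell's concordance `kim_version_concordance.txt`). WHAT
DIFFERS: (i) v3 **Thm. 1.1** is stated for ANY `E/ℚ` and ANY prime `p`: "If (cork1)
`cork_{ℤ_p} Sel(ℚ, E[p^∞]) = 1`, (PRC) Perrin-Riou's conjecture on Kato's zeta elements holds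
(Conjecture 2.2), (IMC) the Iwasawa main conjecture (inverting `p`) holds (Conjecture 2.5), and (res)
the restriction map `res_p : Sel(ℚ, V) → E(ℚ_p) ⊗ ℚ_p` is an isomorphism, then `ord_{s=1} L(E, s)
= 1`. In particular, `rk_ℤ E(ℚ) = 1` and `#Ш(E/ℚ) < ∞`" [v3 TeX L143–L152] — v1's standing "non-CM,
`p > 2` non-additive, `E[p]` irreducible" moved into the inputs Thm. 2.3 / Thm. 2.6; (ii) **Cor. 1.2**
[L156–L165] and **Cor. 1.4** [L175–L178] are v1's WORD FOR WORD (so the statements typed from them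
are unaffected), Rem. 1.3 [L166–L173], Rem. 1.5 [L179–L181]; (iii) NUMBERING v1 → v3 (journal):
Thm. 2.1 (Bertolini–Darmon–Venerucci) → **Thm. 2.3** [L252–L254] "If `E` has semi-stable reduction
at an odd prime `p`, then Conjecture 2.2 is true" (PRC = **Conj. 2.2** [L241–L250]; Rem. 2.4: [BST]
at good `p ≥ 5`); Cor. 2.3 → **Cor. 3.1** [L285–L292]; Thm. 2.4 (finiteness when `L(E,1) ≠ 0`) →
**Thm. 3.2** [L294–L300]; Assumption 2.5 (IMC inverting `p`) → **Conj. 2.5** [L268–L275]; Remark 2.6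
→ **Thm. 2.6** [L276–L281] "(Kato, Skinner–Urban, Wan). If `E` has good ordinary reduction at
`p ≥ 5` and `E[p]` is an irreducible Galois representation, then Conjecture 2.5 is true. Proof. See
[Kat04, Theorem 12.5 and Theorem 17.4], [SU14, Theorem 3.33], and [Wan15, Theorem 4]"; Props. 2.7 +
2.8 → **Prop. 3.3** [L302–L347] (TFAE: `Sel_0(ℚ, E[p^∞])` finite / `z_Kato ≠ 0` / `res_p(z_Kato) ≠ 0`,
under (IMC) and (cork1)); Prop. 2.10 → **Lemma 3.5** [L352–L358]; Remark 2.11 → **Rem. 3.4**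
[L348–L350] "Although (2) ⇒ (3) immediately follows from Assumption (res), we would like to use
Assumption (res) minimally"; assembly sentence [L359–L361]. The reader's informational note on the
(IMC) citation chain at (irr)-not-(sur) images (flag candidate `K22-Thm2.6-IMC@(irr)¬(sur)`, refereed
cover Burungale–Castella–Skinner IMRN 2025 Thm. 1.1.2 (a) = tree fact
`burungale_castella_skinner_charIdeal_eq_padicLFunction`) is the C2 desk's to price (sheet §C.2/F4);
nothing in this file changes with it.

## The printed proof and what the tree already proves of it

`BSDSelmerKimPConverse.lean` proves the printed deductions Cor. 1.4 ⇐ Cor. 1.2 ⇐ Thm. 1.1 (§1 and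
§2 of the source) and Thm. 2.4 (Kato's finiteness) ⇐ Gross–Zagier–Kolyvagin, leaving
`kim_analyticRank_eq_one_of_mordellWeilRank_eq_one_of_kimCore_of_gzk hcore hGZK`, i.e. the named fact
from exactly two statements: `hcore`, **the core of Thm. 1.1 in the setting of Cor. 1.2** (Cor. 2.3
= Bertolini–Darmon–Venerucci, Props. 2.7–2.8 under IMC[`1/p`] inverting `p`, Remark 2.6 —
Kato's Euler system, IMC[`1/p`] by Kato–Skinner–Urban–Wan), stated there inline ("recorded here
verbatim for a future split", module docstring), and `hGZK`, Gross–Zagier–Kolyvagin, the tree's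
named fact `rank_eq_analyticRank_of_analyticRank_le_one` (bsd.S17, `LeadingTerm.lean`).
`BSDSelmerKimPConverseSkeletonProofs.lean` opens `hcore` further along §2 over abstract
`Λ`-module skeleton data and proves the module theory of Props. 2.7–2.8 (no named fact either).

## Contents

* `Kim2022_thm11_core` — NAMED FACT (the new child): verbatim `hcore`.
* `kim_analyticRank_eq_one_of_mordellWeilRank_eq_one_holds_of` — PROVED assembly: the new child
  and Gross–Zagier–Kolyvagin give the parent.

## References

* [Kim2022] C.-H. Kim, Math. Ann. 387 (2023), 1961–1968 (online 2022) = arXiv:2109.12344: Thm. 1.1, Cor. 1.2,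
  Cor. 1.4 (§1); Thm. 2.1, Cor. 2.3, Thm. 2.4, Assumption 2.5, Remark 2.6, Props. 2.7, 2.8, 2.10,
  Remark 2.11 (§2).
* [BertoliniDarmonVenerucci2022] M. Bertolini, H. Darmon, R. Venerucci, Adv. Math. 398 (2022)
  (Thm. 2.1 of the source).
* [Kato2004Asterisque] K. Kato, Astérisque 295 (2004), Thms. 12.4, 17.4; [SkinnerUrban2014]
  C. Skinner, E. Urban, Invent. Math. 195 (2014); X. Wan, Forum Math. Sigma 3 (2015) (Remark 2.6).
-/

noncomputable section

open scoped Classical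

open WeierstrassCurve

namespace Literature.NumberTheory.EllipticCurves

/-! ### The new child: the core of Kim's Thm. 1.1 in the setting of Cor. 1.2 -/

/-- **Kim 2022, Thm. 1.1 (core), in the setting of Cor. 1.2** (as printed in the HELD text arXiv
v1 = `paper:arxiv-2109.12344`, §1, p. 3 — the JOURNAL (= arXiv v3, Math. Ann. 387) restates Thm. 1.1
for any `E`, `p` with (PRC)/(IMC) as named hypotheses and renumbers §2–§3, Cor. 1.2 being identical
word for word: concordance in the module docstring "Text versions"; v1 numbering kept below:
"Theorem 1.1. Let `E` be a non-CM elliptic curve over `ℚ` and `p > 2` a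
non-additive reduction prime for `E`. […] Assume that `E[p]` is an irreducible mod `p` Galois
representation. If (cork1) `cork_{ℤ_p} Sel(ℚ, E[p^∞]) = 1`, (IMC[`1/p`]) the Iwasawa main
conjecture (inverting `p`) holds [= Assumption 2.5], and (res) the restriction map
`res_p : Sel(ℚ, V) → E(ℚ_p) ⊗ ℚ_p` is an isomorphism, then `ord_{s=1} L(E, s) = 1`";
"Corollary 1.2. Let `E` be a non-CM elliptic curve over `ℚ` and `p > 3` a good ordinary prime for
`E`. Assume that `E[p]` is an irreducible mod `p` Galois representation. If (cork1) […] and (res)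
[…], then `ord_{s=1} L(E, s) = 1`" — i.e. Thm. 1.1 WITHOUT (IMC[`1/p`]), by the work of Kato,
Skinner–Urban and X. Wan; THIS declaration is typed in Cor. 1.2's setting — good ordinary `p > 3` —
which is narrower than Thm. 1.1's "non-additive `p > 2`"; "Remark 2.6. When `p ≥ 5` is good
ordinary for `E` and `E[p]` is an
irreducible Galois representation, Assumption 2.5 follows from the work of Kato, Skinner–Urban, and
X. Wan"; proof, §2: "Theorem 1.1 follows from the combination of Corollary 2.3 [Bertolini–Darmon–
Venerucci, under `L(E, 1) = 0`], Theorem 2.4 [Kato], Proposition 2.7, Proposition 2.8, and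
Proposition 2.10", Remark 2.11: "Assumption (res) is crucially and only used in Proposition 2.10
[(cork1) and (res) ⟹ `Sel_0(ℚ, E[p^∞])` finite]"). Vendored as the implication the printed proof
establishes ONCE Kato's Thm. 2.4 and Prop. 2.10 are set aside (both are theorems or facts of the
tree: `kato_finite_of_L_one_ne_zero_of_rank_eq_analyticRank`,
`finite_strictSelmer_of_mordellWeilRank_eq_one`): for the globally minimal model `W` of a non-CM
`E/ℚ` (`¬ W.HasCM`), a prime `p > 3` of good ordinary reduction (`HasGoodReductionAtPrime`,
`p ∤ a_p(E)` = `frobeniusTrace`) with `E[p]` irreducible (`HasIrreducibleModPGaloisRep`), IF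
`L(E, 1) = 0` (`W.entireLFunction 1 = 0`), `cork_{ℤ_p} Sel_{p^∞}(E/ℚ) = 1` (`W.selmerCorank p = 1`)
and the `p`-strict Selmer group `Sel_0(ℚ, E[p^∞]) = Sel_{p^∞}(E/ℚ) ∩ ker (H¹(ℚ, E[p^∞]) →
H¹(ℚ_p, E[p^∞]))` (`W.selmerGroupPInfty p ⊓ selmerLocalKerPrimaryTorsion W ℚ_[p] p`) is finite —
the `p^∞`-avatar of (res), equivalent to it under (cork1) by the source's Prop. 2.10 and the proof
of Prop. 2.8 — THEN `ord_{s=1} L(E, s) = 1` (`W.analyticRank = 1`). Content: Kato's Euler system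
and explicit reciprocity law, IMC[`1/p`] (a theorem of Kato, Skinner–Urban and Wan for `p ≥ 5`
good ordinary with `E[p]` irreducible, Remark 2.6), Kurihara's control theorem for `Sel_0`, and
Bertolini–Darmon–Venerucci's Heegner-point formula for Beilinson–Kato elements, Thm. 2.1 (size
XL; the `Λ`-module skeleton of Props. 2.7–2.8 is proved in
`BSDSelmerKimPConverseSkeletonProofs.lean`). Verbatim the hypothesis `hcore` of
`kim_analyticRank_eq_one_of_mordellWeilRank_eq_one_of_kimCore_of_gzk`.
[cite: Kim2022, Cor. 1.2 (§1) with Thm. 1.1; journal (= arXiv v3) numbering Thm. 2.3, Thm. 2.6, Cor. 3.1, Prop. 3.3, Rem. 3.4 (v3 TeX L143–L165, L252–L281, L285–L350) = arXiv v1 numbering Thm. 2.1, Remark 2.6, Cor. 2.3, Props. 2.7–2.8, Remark 2.11] -/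
def Kim2022_thm11_core : Prop :=
  ∀ (W : WeierstrassCurve ℚ) [W.IsElliptic] [W.IsGloballyMinimal], ¬ W.HasCM →
    ∀ (p : ℕ) [Fact p.Prime], 3 < p → W.HasGoodReductionAtPrime p →
    ¬ (p : ℤ) ∣ W.frobeniusTrace p → W.HasIrreducibleModPGaloisRep p →
    W.entireLFunction 1 = 0 → W.selmerCorank p = 1 →
    Finite ↥(W.selmerGroupPInfty p ⊓ selmerLocalKerPrimaryTorsion W ℚ_[p] p) →
    W.analyticRank = 1

/-! ### Assembly -/

/-- **Assembly of the split of bsd.S25 (Kim 2022, Cor. 1.4)**: the core of Thm. 1.1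
(`Kim2022_thm11_core`) and Gross–Zagier–Kolyvagin (`rank_eq_analyticRank_of_analyticRank_le_one`,
bsd.S17) give `kim_analyticRank_eq_one_of_mordellWeilRank_eq_one`, by the tree's
`kim_analyticRank_eq_one_of_mordellWeilRank_eq_one_of_kimCore_of_gzk` (`BSDSelmerKimPConverse.lean`:
(cork1) from `rk = 1`, `#Ш[p^∞] < ∞`; `Sel_0` finite by the rank-one lemma; Kato's Thm. 2.4 from
Gross–Zagier–Kolyvagin; the "in particular" clauses).
[cite: Kim2022, Cor. 1.4 (deduction from Cor. 1.2, §1) and §2] -/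
theorem kim_analyticRank_eq_one_of_mordellWeilRank_eq_one_holds_of :
    Kim2022_thm11_core → rank_eq_analyticRank_of_analyticRank_le_one →
      kim_analyticRank_eq_one_of_mordellWeilRank_eq_one :=
  fun hcore hGZK => kim_analyticRank_eq_one_of_mordellWeilRank_eq_one_of_kimCore_of_gzk hcore hGZK

end Literature.NumberTheory.EllipticCurves

end
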